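import Summits.Ventures.PercRepro.Graph
import Summits.Ventures.PercRepro.Partition

/-!
# C-005 — the `k = 4` crossing pair-sum inequality: statement, cell interface, AD instances

For four marked vertices `a, b, c, d` write
`top = P(a~b~c~d)`, `bot = P(a|b|c|d)`, `x₁ = P(ab|cd)`, `x₂ = P(ac|bd)`, `x₃ = P(ad|bc)`
(the three *crossing* two-block partitions). The cell's candidate **C-005**
(`conjectures/C-005.md`, lead 2026-08-22, census 0/205,686 on n ≤ 7) is
`top · bot ≥ x₁x₂ + x₁x₃ + x₂x₃`.

This file provides, on typer-1's `Graph.lean` and typer-2's `Partition.lean`: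
* the five cells as connection events (`topEvent`, `botEvent`, `crossEvent₁/₂/₃`, the engine
  strings of `C-005.md`) and as engine law rows (`partitionEvent_row4_*`, the `rgs4` rows
  `0000`, `0011`, `0101`, `0110`, `0123` of typer-2's `SMC.lean`), via `mem_partitionEvent_four`;
* the five cells as setoids on `Fin 4` and the lattice facts behind the AD instances:
  crossing cells are pairwise complementary, `σᵢ ⊔ σⱼ = ⊤`, `σᵢ ⊓ σⱼ = ⊥` (`i ≠ j`);
* the three **Ahlswede–Daykin instances** `xᵢ xⱼ ≤ top · bot` (`ad_cross₁₂`, `ad_cross₁₃`,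
  `ad_cross₂₃`, from typer-2's `ahlswede_daykin_partition`) and their sum
  `e₂(x) ≤ 3 · top · bot` (`C005_weak`), the known-cone bound C-005 sharpens by the factor 3;
* the statement `C005conn` as a named Prop. The edge-reveal identity, the polarised cross term
  `M` and the reduction of C-005 to `M ≥ 0` are in `Summits.Ventures.PercRepro.C005CrossTerm`.
-/

namespace PercRepro

open Finset

variable {V E : Type*}

namespace MultiGraph

variable (G : MultiGraph V E)

/-! ### The five cells as connection events -/

section Cells

variable (a b c d : V)

/-- `top = {a ~ b ~ c ~ d}` (engine: `conn a b & conn b c & conn c d`). -/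
def topEvent : Set (Config E) := G.connEvent a b ∩ G.connEvent b c ∩ G.connEvent c d

/-- `bot = {a | b | c | d}` (engine: `sep` over the six pairs). -/
def botEvent : Set (Config E) :=
  G.sepEvent a b ∩ G.sepEvent a c ∩ G.sepEvent a d ∩ G.sepEvent b c ∩ G.sepEvent b d ∩
    G.sepEvent c d

/-- `x₁ = {ab | cd}` (engine: `conn a b & conn c d & sep a c`). -/
def crossEvent₁ : Set (Config E) := G.connEvent a b ∩ G.connEvent c d ∩ G.sepEvent a c

/-- `x₂ = {ac | bd}` (engine: `conn a c & conn b d & sep a b`). -/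
def crossEvent₂ : Set (Config E) := G.connEvent a c ∩ G.connEvent b d ∩ G.sepEvent a b

/-- `x₃ = {ad | bc}` (engine: `conn a d & conn b c & sep a b`). -/
def crossEvent₃ : Set (Config E) := G.connEvent a d ∩ G.connEvent b c ∩ G.sepEvent a b

variable {a b c d} {ω : Config E}

/-- Membership in `topEvent`: `a ~ b ~ c ~ d`. -/
theorem mem_topEvent : ω ∈ G.topEvent a b c d ↔ G.Conn ω a b ∧ G.Conn ω b c ∧ G.Conn ω c d := by
  simp [topEvent, and_assoc]

/-- Membership in `botEvent`: the four marks are pairwise disconnected. -/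
theorem mem_botEvent : ω ∈ G.botEvent a b c d ↔
    ¬ G.Conn ω a b ∧ ¬ G.Conn ω a c ∧ ¬ G.Conn ω a d ∧ ¬ G.Conn ω b c ∧ ¬ G.Conn ω b d ∧
      ¬ G.Conn ω c d := by
  simp [botEvent, and_assoc]

/-- Membership in `crossEvent₁`: `a ~ b`, `c ~ d`, `a ≁ c`. -/
theorem mem_crossEvent₁ : ω ∈ G.crossEvent₁ a b c d ↔
    G.Conn ω a b ∧ G.Conn ω c d ∧ ¬ G.Conn ω a c := by
  simp [crossEvent₁, and_assoc]

/-- Membership in `crossEvent₂`: `a ~ c`, `b ~ d`, `a ≁ b`. -/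
theorem mem_crossEvent₂ : ω ∈ G.crossEvent₂ a b c d ↔
    G.Conn ω a c ∧ G.Conn ω b d ∧ ¬ G.Conn ω a b := by
  simp [crossEvent₂, and_assoc]

/-- Membership in `crossEvent₃`: `a ~ d`, `b ~ c`, `a ≁ b`. -/
theorem mem_crossEvent₃ : ω ∈ G.crossEvent₃ a b c d ↔
    G.Conn ω a d ∧ G.Conn ω b c ∧ ¬ G.Conn ω a b := by
  simp [crossEvent₃, and_assoc]

end Cells

/-! ### The engine law rows at `k = 4` -/

section Rows4

variable {ω : Config E} (a b c d : V)

/-- Membership in a `k = 4` partition row reduces to the six atoms. -/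
theorem mem_partitionEvent_four (r : Fin 4 → ℕ) :
    ω ∈ G.partitionEvent ![a, b, c, d] r ↔
      (G.Conn ω a b ↔ r 0 = r 1) ∧ (G.Conn ω a c ↔ r 0 = r 2) ∧ (G.Conn ω a d ↔ r 0 = r 3) ∧
        (G.Conn ω b c ↔ r 1 = r 2) ∧ (G.Conn ω b d ↔ r 1 = r 3) ∧ (G.Conn ω c d ↔ r 2 = r 3) := by
  constructor
  · intro h
    exact ⟨h 0 1, h 0 2, h 0 3, h 1 2, h 1 3, h 2 3⟩
  · rintro ⟨hab, hac, had, hbc, hbd, hcd⟩ i j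
    have hba : G.Conn ω b a ↔ r 1 = r 0 := by rw [G.conn_comm, hab, eq_comm]
    have hca : G.Conn ω c a ↔ r 2 = r 0 := by rw [G.conn_comm, hac, eq_comm]
    have hda : G.Conn ω d a ↔ r 3 = r 0 := by rw [G.conn_comm, had, eq_comm]
    have hcb : G.Conn ω c b ↔ r 2 = r 1 := by rw [G.conn_comm, hbc, eq_comm]
    have hdb : G.Conn ω d b ↔ r 3 = r 1 := by rw [G.conn_comm, hbd, eq_comm]
    have hdc : G.Conn ω d c ↔ r 3 = r 2 := by rw [G.conn_comm, hcd, eq_comm]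
    fin_cases i <;> fin_cases j <;>
      simp [hab, hac, had, hbc, hbd, hcd, hba, hca, hda, hcb, hdb, hdc, Conn.refl]

/-- Transitivity among the six atoms of four vertices (for `tauto`). -/
theorem conn_four_trans :
    (G.Conn ω a b → G.Conn ω b c → G.Conn ω a c) ∧ (G.Conn ω a b → G.Conn ω a c → G.Conn ω b c) ∧
    (G.Conn ω a c → G.Conn ω b c → G.Conn ω a b) ∧ (G.Conn ω a b → G.Conn ω b d → G.Conn ω a d) ∧
    (G.Conn ω a b → G.Conn ω a d → G.Conn ω b d) ∧ (G.Conn ω a d → G.Conn ω b d → G.Conn ω a b) ∧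
    (G.Conn ω a c → G.Conn ω c d → G.Conn ω a d) ∧ (G.Conn ω a c → G.Conn ω a d → G.Conn ω c d) ∧
    (G.Conn ω a d → G.Conn ω c d → G.Conn ω a c) ∧ (G.Conn ω b c → G.Conn ω c d → G.Conn ω b d) ∧
    (G.Conn ω b c → G.Conn ω b d → G.Conn ω c d) ∧ (G.Conn ω b d → G.Conn ω c d → G.Conn ω b c) :=
  ⟨fun h h' => h.trans h', fun h h' => h.symm.trans h', fun h h' => h.trans h'.symm,
    fun h h' => h.trans h', fun h h' => h.symm.trans h', fun h h' => h.trans h'.symm,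
    fun h h' => h.trans h', fun h h' => h.symm.trans h', fun h h' => h.trans h'.symm,
    fun h h' => h.trans h', fun h h' => h.symm.trans h', fun h h' => h.trans h'.symm⟩

/-- Row `0000`: `abcd`. -/
theorem partitionEvent_row4_top :
    G.partitionEvent ![a, b, c, d] ![0, 0, 0, 0] = G.topEvent a b c d := by
  ext ω
  obtain ⟨h1, -, -, -, -, -, h7, -, -, h10, -, -⟩ := G.conn_four_trans a b c d (ω := ω)
  simp only [mem_partitionEvent_four, mem_topEvent]
  simp
  tauto

/-- Row `0123`: `a|b|c|d`. -/
theorem partitionEvent_row4_bot :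
    G.partitionEvent ![a, b, c, d] ![0, 1, 2, 3] = G.botEvent a b c d := by
  ext ω
  simp only [mem_partitionEvent_four, mem_botEvent]
  simp

/-- Row `0011`: `ab|cd`. -/
theorem partitionEvent_row4_cross₁ :
    G.partitionEvent ![a, b, c, d] ![0, 0, 1, 1] = G.crossEvent₁ a b c d := by
  ext ω
  obtain ⟨h1, -, -, h4, -, -, -, -, h9, -, -, -⟩ := G.conn_four_trans a b c d (ω := ω)
  simp only [mem_partitionEvent_four, mem_crossEvent₁]
  simp
  tauto

/-- Row `0101`: `ac|bd`. -/
theorem partitionEvent_row4_cross₂ :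
    G.partitionEvent ![a, b, c, d] ![0, 1, 0, 1] = G.crossEvent₂ a b c d := by
  ext ω
  obtain ⟨-, -, h3, -, -, h6, h7, -, -, -, -, -⟩ := G.conn_four_trans a b c d (ω := ω)
  simp only [mem_partitionEvent_four, mem_crossEvent₂]
  simp
  tauto

/-- Row `0110`: `ad|bc`. -/
theorem partitionEvent_row4_cross₃ :
    G.partitionEvent ![a, b, c, d] ![0, 1, 1, 0] = G.crossEvent₃ a b c d := by
  ext ω
  obtain ⟨-, -, h3, -, -, h6, -, -, h9, -, -, -⟩ := G.conn_four_trans a b c d (ω := ω)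
  simp only [mem_partitionEvent_four, mem_crossEvent₃]
  simp
  tauto

end Rows4

end MultiGraph

/-! ### The five cells as setoids on `Fin 4` and the lattice facts -/

namespace Cross4

/-- `ab|cd` as a setoid on the marked indices. -/
def σ₁ : Setoid (Fin 4) := Setoid.ker ![0, 0, 1, 1]
/-- `ac|bd`. -/
def σ₂ : Setoid (Fin 4) := Setoid.ker ![0, 1, 0, 1]
/-- `ad|bc`. -/
def σ₃ : Setoid (Fin 4) := Setoid.ker ![0, 1, 1, 0]

/-- A setoid on `Fin 4` relating `0` to everything is `⊤`. -/
theorem eq_top_of_rel_zero (s : Setoid (Fin 4)) (h1 : s 0 1) (h2 : s 0 2) (h3 : s 0 3) :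
    s = ⊤ := by
  refine Setoid.eq_top_iff.2 fun x y => ?_
  have h0 : ∀ z, s 0 z := by
    intro z
    fin_cases z
    · exact s.refl 0
    · exact h1
    · exact h2
    · exact h3
  exact s.trans (s.symm (h0 x)) (h0 y)

/-- `σ₁` identifies `{0, 1}` and `{2, 3}`. -/
theorem σ₁_rel (i j : Fin 4) : σ₁ i j ↔ (![0, 0, 1, 1] : Fin 4 → ℕ) i = ![0, 0, 1, 1] j :=
  Setoid.ker_def
/-- `σ₂` identifies `{0, 2}` and `{1, 3}`. -/
theorem σ₂_rel (i j : Fin 4) : σ₂ i j ↔ (![0, 1, 0, 1] : Fin 4 → ℕ) i = ![0, 1, 0, 1] j :=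
  Setoid.ker_def
/-- `σ₃` identifies `{0, 3}` and `{1, 2}`. -/
theorem σ₃_rel (i j : Fin 4) : σ₃ i j ↔ (![0, 1, 1, 0] : Fin 4 → ℕ) i = ![0, 1, 1, 0] j :=
  Setoid.ker_def

/-- Two distinct crossing cells join to `⊤`. -/
theorem sup₁₂ : σ₁ ⊔ σ₂ = ⊤ := by
  refine eq_top_of_rel_zero _ (le_sup_left (a := σ₁) (b := σ₂) ?_)
    (le_sup_right (a := σ₁) (b := σ₂) ?_) ?_
  · rw [σ₁_rel]; decide
  · rw [σ₂_rel]; decide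
  · exact (σ₁ ⊔ σ₂).trans (le_sup_right (a := σ₁) (b := σ₂) (by rw [σ₂_rel]; decide : σ₂ 0 2))
      (le_sup_left (a := σ₁) (b := σ₂) (by rw [σ₁_rel]; decide : σ₁ 2 3))

/-- `σ₁ ⊔ σ₃ = ⊤`. -/
theorem sup₁₃ : σ₁ ⊔ σ₃ = ⊤ := by
  refine eq_top_of_rel_zero _ (le_sup_left (a := σ₁) (b := σ₃) ?_) ?_
    (le_sup_right (a := σ₁) (b := σ₃) ?_)
  · rw [σ₁_rel]; decide
  · exact (σ₁ ⊔ σ₃).trans (le_sup_left (a := σ₁) (b := σ₃) (by rw [σ₁_rel]; decide : σ₁ 0 1))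
      (le_sup_right (a := σ₁) (b := σ₃) (by rw [σ₃_rel]; decide : σ₃ 1 2))
  · rw [σ₃_rel]; decide

/-- `σ₂ ⊔ σ₃ = ⊤`. -/
theorem sup₂₃ : σ₂ ⊔ σ₃ = ⊤ := by
  refine eq_top_of_rel_zero _ ?_ (le_sup_left (a := σ₂) (b := σ₃) ?_)
    (le_sup_right (a := σ₂) (b := σ₃) ?_)
  · exact (σ₂ ⊔ σ₃).trans (le_sup_left (a := σ₂) (b := σ₃) (by rw [σ₂_rel]; decide : σ₂ 0 2))
      (le_sup_right (a := σ₂) (b := σ₃) (by rw [σ₃_rel]; decide : σ₃ 2 1))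
  · rw [σ₂_rel]; decide
  · rw [σ₃_rel]; decide

/-- Two distinct crossing cells meet in `⊥`. -/
theorem inf₁₂ : σ₁ ⊓ σ₂ = ⊥ := by
  refine le_antisymm (Setoid.le_def.2 fun {x y} h => ?_) bot_le
  rw [Setoid.inf_iff_and, σ₁_rel, σ₂_rel] at h
  show x = y
  revert h
  revert x y
  decide

/-- `σ₁ ⊓ σ₃ = ⊥`. -/
theorem inf₁₃ : σ₁ ⊓ σ₃ = ⊥ := by
  refine le_antisymm (Setoid.le_def.2 fun {x y} h => ?_) bot_le
  rw [Setoid.inf_iff_and, σ₁_rel, σ₃_rel] at h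
  show x = y
  revert h
  revert x y
  decide

/-- `σ₂ ⊓ σ₃ = ⊥`. -/
theorem inf₂₃ : σ₂ ⊓ σ₃ = ⊥ := by
  refine le_antisymm (Setoid.le_def.2 fun {x y} h => ?_) bot_le
  rw [Setoid.inf_iff_and, σ₂_rel, σ₃_rel] at h
  show x = y
  revert h
  revert x y
  decide

end Cross4

/-! ### The three Ahlswede–Daykin instances -/

namespace MultiGraph

variable [Fintype E] [DecidableEq E] (G : MultiGraph V E)

omit [Fintype E] [DecidableEq E] in
/-- `⊤ ≤ Π(ω)` means all four marked vertices are connected. -/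
theorem mem_topEvent_of_top_le {ω : Config E} {a b c d : V}
    (h : ⊤ ≤ G.markedPartition ω ![a, b, c, d]) : ω ∈ G.topEvent a b c d := by
  have hall : ∀ i j : Fin 4, G.Conn ω (![a, b, c, d] i) (![a, b, c, d] j) := fun i j =>
    (G.markedPartition_rel ω ![a, b, c, d] i j).1 (Setoid.le_def.1 h (by rw [Setoid.top_def]; trivial))
  exact (G.mem_topEvent).2 ⟨hall 0 1, hall 1 2, hall 2 3⟩

omit [Fintype E] [DecidableEq E] in
/-- `Π(ω) ≤ ⊥` means the four marked vertices are pairwise disconnected. -/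
theorem mem_botEvent_of_le_bot {ω : Config E} {a b c d : V}
    (h : G.markedPartition ω ![a, b, c, d] ≤ ⊥) : ω ∈ G.botEvent a b c d := by
  have hne : ∀ i j : Fin 4, i ≠ j → ¬ G.Conn ω (![a, b, c, d] i) (![a, b, c, d] j) := by
    intro i j hij hc
    have := Setoid.le_def.1 h ((G.markedPartition_rel ω ![a, b, c, d] i j).2 hc)
    rw [Setoid.bot_def] at this
    exact hij this
  exact (G.mem_botEvent).2 ⟨hne 0 1 (by decide), hne 0 2 (by decide), hne 0 3 (by decide),
    hne 1 2 (by decide), hne 1 3 (by decide), hne 2 3 (by decide)⟩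

/-- **AD instance for a complementary pair of cells**: if `σ ⊔ τ = ⊤` and `σ ⊓ τ = ⊥` then
`P(Π = σ) P(Π = τ) ≤ top · bot`. -/
theorem ad_cell_mul_le {p : E → ℝ} (hp : IsProb p) (a b c d : V) {σ τ : Setoid (Fin 4)}
    (hsup : σ ⊔ τ = ⊤) (hinf : σ ⊓ τ = ⊥) :
    prob p (G.partitionSetoidEvent ![a, b, c, d] σ) *
        prob p (G.partitionSetoidEvent ![a, b, c, d] τ) ≤
      prob p (G.topEvent a b c d) * prob p (G.botEvent a b c d) := by
  have h := G.ahlswede_daykin_partition hp ![a, b, c, d] {σ} {τ}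
  rw [G.partitionIn_singleton, G.partitionIn_singleton] at h
  refine h.trans (mul_le_mul (prob_mono hp ?_) (prob_mono hp ?_) (prob_nonneg hp _)
    (prob_nonneg hp _))
  · intro ω hω
    have hmem : G.markedPartition ω ![a, b, c, d] ∈
        (upperClosure (Set.image2 (· ⊔ ·) {σ} {τ}) : Set (Setoid (Fin 4))) := hω
    rw [Set.image2_singleton, hsup, SetLike.mem_coe, mem_upperClosure] at hmem
    obtain ⟨ρ, hρ, hle⟩ := hmem
    rw [Set.mem_singleton_iff] at hρ
    subst hρ
    exact G.mem_topEvent_of_top_le hle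
  · intro ω hω
    have hmem : G.markedPartition ω ![a, b, c, d] ∈
        (lowerClosure (Set.image2 (· ⊓ ·) {σ} {τ}) : Set (Setoid (Fin 4))) := hω
    rw [Set.image2_singleton, hinf, SetLike.mem_coe, mem_lowerClosure] at hmem
    obtain ⟨ρ, hρ, hle⟩ := hmem
    rw [Set.mem_singleton_iff] at hρ
    subst hρ
    exact G.mem_botEvent_of_le_bot hle

omit [Fintype E] [DecidableEq E] in
/-- `crossEvent₁` is the partition event of `σ₁` on the marks `a, b, c, d`. -/
theorem crossEvent₁_eq_partitionSetoidEvent (a b c d : V) :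
    G.crossEvent₁ a b c d = G.partitionSetoidEvent ![a, b, c, d] Cross4.σ₁ := by
  rw [← G.partitionEvent_row4_cross₁, G.partitionEvent_eq_partitionSetoidEvent]
  rfl

omit [Fintype E] [DecidableEq E] in
/-- `crossEvent₂` is the partition event of `σ₂` on the marks `a, b, c, d`. -/
theorem crossEvent₂_eq_partitionSetoidEvent (a b c d : V) :
    G.crossEvent₂ a b c d = G.partitionSetoidEvent ![a, b, c, d] Cross4.σ₂ := by
  rw [← G.partitionEvent_row4_cross₂, G.partitionEvent_eq_partitionSetoidEvent]
  rfl

omit [Fintype E] [DecidableEq E] in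
/-- `crossEvent₃` is the partition event of `σ₃` on the marks `a, b, c, d`. -/
theorem crossEvent₃_eq_partitionSetoidEvent (a b c d : V) :
    G.crossEvent₃ a b c d = G.partitionSetoidEvent ![a, b, c, d] Cross4.σ₃ := by
  rw [← G.partitionEvent_row4_cross₃, G.partitionEvent_eq_partitionSetoidEvent]
  rfl

/-- **(K1) instance** `x₁ x₂ ≤ top · bot`. -/
theorem ad_cross₁₂ {p : E → ℝ} (hp : IsProb p) (a b c d : V) :
    prob p (G.crossEvent₁ a b c d) * prob p (G.crossEvent₂ a b c d) ≤
      prob p (G.topEvent a b c d) * prob p (G.botEvent a b c d) := by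
  rw [G.crossEvent₁_eq_partitionSetoidEvent, G.crossEvent₂_eq_partitionSetoidEvent]
  exact G.ad_cell_mul_le hp a b c d Cross4.sup₁₂ Cross4.inf₁₂

/-- **(K1) instance** `x₁ x₃ ≤ top · bot`. -/
theorem ad_cross₁₃ {p : E → ℝ} (hp : IsProb p) (a b c d : V) :
    prob p (G.crossEvent₁ a b c d) * prob p (G.crossEvent₃ a b c d) ≤
      prob p (G.topEvent a b c d) * prob p (G.botEvent a b c d) := by
  rw [G.crossEvent₁_eq_partitionSetoidEvent, G.crossEvent₃_eq_partitionSetoidEvent]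
  exact G.ad_cell_mul_le hp a b c d Cross4.sup₁₃ Cross4.inf₁₃

/-- **(K1) instance** `x₂ x₃ ≤ top · bot`. -/
theorem ad_cross₂₃ {p : E → ℝ} (hp : IsProb p) (a b c d : V) :
    prob p (G.crossEvent₂ a b c d) * prob p (G.crossEvent₃ a b c d) ≤
      prob p (G.topEvent a b c d) * prob p (G.botEvent a b c d) := by
  rw [G.crossEvent₂_eq_partitionSetoidEvent, G.crossEvent₃_eq_partitionSetoidEvent]
  exact G.ad_cell_mul_le hp a b c d Cross4.sup₂₃ Cross4.inf₂₃

/-- The known-cone bound: `x₁x₂ + x₁x₃ + x₂x₃ ≤ 3 · top · bot` (sum of the three AD instances).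
C-005 is the factor-3 sharpening. -/
theorem C005_weak {p : E → ℝ} (hp : IsProb p) (a b c d : V) :
    prob p (G.crossEvent₁ a b c d) * prob p (G.crossEvent₂ a b c d) +
        prob p (G.crossEvent₁ a b c d) * prob p (G.crossEvent₃ a b c d) +
        prob p (G.crossEvent₂ a b c d) * prob p (G.crossEvent₃ a b c d) ≤
      3 * (prob p (G.topEvent a b c d) * prob p (G.botEvent a b c d)) := by
  have h1 := G.ad_cross₁₂ hp a b c d
  have h2 := G.ad_cross₁₃ hp a b c d
  have h3 := G.ad_cross₂₃ hp a b c d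
  linarith

end MultiGraph

/-- **C-005** (the `k = 4` crossing pair-sum inequality, `conjectures/C-005.md`), as a named Prop
in connection-event form: for every finite multigraph, every `p ∈ [0,1]^E` and all vertices
`a, b, c, d`, `x₁x₂ + x₁x₃ + x₂x₃ ≤ top · bot`. -/
def C005conn : Prop :=
  ∀ {V E : Type} [Fintype E] [DecidableEq E] (G : MultiGraph V E) (p : E → ℝ), IsProb p →
    ∀ a b c d : V,
      prob p (G.crossEvent₁ a b c d) * prob p (G.crossEvent₂ a b c d) +
        prob p (G.crossEvent₁ a b c d) * prob p (G.crossEvent₃ a b c d) +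
        prob p (G.crossEvent₂ a b c d) * prob p (G.crossEvent₃ a b c d) ≤
      prob p (G.topEvent a b c d) * prob p (G.botEvent a b c d)

end PercRepro
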